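import Summits.CriticalPhenomena.CardyFormulaZ2.Theses.CardyRotToConf
import Summits.CriticalPhenomena.CardyFormulaZ2.Theses.CardySelfRefinement
import Literature.Probability.Percolation.SmirnovTheoremProofs
import Literature.Probability.RandomPlanarGeometry.ChordalReversibility
import Literature.Probability.RandomPlanarGeometry.CritPercSLE
import Literature.AlgebraicTopology.FundamentalGroup.PuncturedPlane

/-!
# Line `continuum-smirnov-dipole` — crux skeleton for stmt-CriticalPhenomena-0698
(`CardyRotToConfR2SymmetryUpgrade`, shared decl `CardySelfRefinement.SymmetryUpgrade`)

Crux (typed, FIXED): every similarity-covariant, domain-Markov, local, target-independent chordal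
family `P` that a.s. traces no boundary arc is the chordal SLE₆ law in every Dobrushin domain.

## The line (idea card `continuum-smirnov-dipole`, ideator 1; pipeline as quoted in the triage:
`BoundaryDuality` + `SmirnovTripleIdentity` → tree `smirnov_claim24` → `JordanCardyToSLE6`)

Run Smirnov's harmonic-triple proof of Cardy's formula IN THE CONTINUUM for the abstract family.
For a conformal rectangle `R = (Ω; a', b', c', d')` and the 3-marked domain `T = forgetLast R`
(arcs `A₀ = (a'b')`, `A₁ = (b'c')`, `A₂ = (c'd'a')`) the **separation function**
`Gⁱ(z) = sepFun P T i z` is the `P`-probability of Smirnov's event "`z` is separated from the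
arc `Aᵢ` by an (interior, `A_{i+1}`–`A_{i+2}`) crossing", rendered on ONE curve of the family:
the curve of `(T; pt i, pt (i+1))` (the interface bounding the cluster of `Aᵢ`), its SPANNING
PIECE `γ|[t_L, t_R]` (from the last visit of the side `A_{i+2}` before the first visit `t_R`
of the side `A_{i+1}`), closed up along `∂Ω` through the opposite vertex `pt (i+2)`; the event
is "`z ∉` spanning piece and the winding number of that loop around `z` is `≠ 0`" (percolation
dictionary in the docstring of `smirnovEvent`). The "dipole" is the odd first-order increment
`Gⁱ(z+εη) − Gⁱ(z)` (Smirnov's `P_α(z,η) − P_α(z+η,−η)`, eq. (3) of arXiv:0909.4499).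

* `stub_cellDipole` (THE BET; consumes rotation covariance): the mesoscopic `2π/3` dipole
  identity `Gⁱ(z+εη) − Gⁱ(z) − (G^{i+1}(z+εωη) − G^{i+1}(z)) = o(ε)` uniformly on compacts of
  `Ω`, `ω = triangleTurn a b c` for a Carleson datum (derivative form of Bollobás–Riordan (36);
  Smirnov's Lemma 2.1 is its lattice shadow). Intended proof: exact colour switching of the
  `P`-exploration structure (Markov + locality + target independence + achirality) for three-arm
  events from an artificial `ε`-cell, plus isotropy of the first-order response (similarity
  covariance) — the two derivations of (36) of the merged cards dipole/triple.
* `stub_contourFromCells` (pure analysis, M): the uniform dipole identity for continuous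
  functions on an open set implies the contour relation (36) on every solid triangle
  (mollify: for smooth `G` the identity says `∂̄G^{i+1} = ω ∂̄Gⁱ`; Green).
* `stub_boundaryDuality` (L): the three separation functions extend continuously to `closure Ω`
  with values in `[0,1]`, boundary values (37) (`Gⁱ = 0` on `Aᵢ`, `G^{i+1}+G^{i+2} = 1` on `Aᵢ`:
  the crossing duality, where achirality/target independence enter) and the Carleson-point
  identification `G¹(d') = P[curve a'→c' hits (c'd') before (b'c')]`.
* composition (PROVED here): `smirnov_claim24_holds` (Morera + argument principle, PROVED in
  tree) identifies `G` with the Carleson linear functions; the boundary limit at `d'` and the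
  Cardy–Carleson identity (`cardyFunction_crossRatio_eq_carlesonRatio_holds`,
  `exists_isCarlesonMap_holds`) give Cardy's formula for `P` in EVERY conformal rectangle
  (`CardyCrossing P`, the shape of crit-perc.S21 `sle_six_measureReal_hitsBefore`).
* `stub_jordanCardyToSLE6` (XL, known template: Smirnov 2001 Thm 2 / Camia–Newman 2007 Thm 5 /
  Werner 2007 §4; the common back end F3 of all positive lines, filed once, typed over
  `ConformalRectangle` with `hitsBefore (R.arc 2) (R.arc 1)` for `R.chord 0 2` as the triage
  asked): admissible + Cardy in all conformal rectangles ⇒ `IsSLELaw 6 D (P D)`.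
* `stub_aprioriFromAxioms` (TRANSFER): typed hypotheses ⇒ the a-priori package
  `SmirnovRegular P` = {reflection covariance (achirality), no fixed interior point is hit,
  instant return to both boundary arcs}. This is the stub that is FALSE iff the typed crux is
  false by the germ-decorated junk on record (J1/J2''/bisector explorers all violate
  `noPointHit`/`instantReturn`); under the repaired crux (clause (iv) / E4 / reversibility) it
  becomes a hypothesis and the other four stubs are untouched.

## Disproof.lean (cdisprove v2) obstructions honoured
`_false_without_isChordal/targetClause`: `stub_boundaryDuality` uses the target clause (for
`tipFamily` all `Gⁱ ≡ 0`, so (37) fails) · rotation tightness (TightnessNotes B1, stretched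
SLE₆): consumed in `stub_cellDipole` only · `not_crux_of_two_families` / crux ⇒ `HasSLETrace 6`:
`stub_jordanCardyToSLE6` must produce the SLE₆ law from `P`'s own curves (Camia–Newman route:
the driving function of `P D` is `√6 B`, trace existence comes from `P`, not from Rohde–Schramm)
· arcFamily / P^ccw: excluded by `NonTracing` and by `instantReturn` · explorer (§5): violates
`noPointHit`.

Only the five `stub_*` theorems use `sorry`. `crux_of_stubStatements` (stub STATEMENTS ⇒ crux
statement) is proved on the standard axioms; `CardyRotToConfR2SymmetryUpgrade_of` and
`SymmetryUpgrade_of` apply it to the registered stubs and conclude the two route decls BY NAME.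
-/

noncomputable section

open MeasureTheory Set Filter Topology Metric
open scoped unitInterval Classical
open UpperHalfPlane (upperHalfPlaneSet)
open Literature.Probability.RandomPlanarGeometry
open Literature.Probability.Percolation (openTriangle IsEquilateral carlesonRatio IsCarlesonMap
  triangleIntegral triangleTurn carlesonLinear smirnov_claim24_holds exists_isCarlesonMap_holds
  cardyFunction_crossRatio_eq_carlesonRatio_holds norm_triangleTurn_of_isEquilateral
  continuous_carlesonLinear carlesonLinear_one_eq_carlesonRatio)
open Literature.AlgebraicTopology.FundamentalGroup.PuncturedPlane (CStar expCover
  isCoveringMap_expCover)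

namespace Summit.CriticalPhenomena.CardyFormulaZ2.Cruxes.CardyRotToConfR2SymmetryUpgrade.ContinuumSmirnovDipole

/-! ### The crux's own clause and the Cardy conclusion shape -/

/-- The non-tracing clause of the crux, verbatim: `P`-a.s. no non-trivial sub-arc of the curve
lies in `∂D`. -/
def NonTracing (P : ChordalFamily) : Prop :=
  ∀ D : DobrushinDomain, ∀ᵐ γ ∂(P D), ∀ c : Curve ℂ, CurveClass.mk c = γ →
    ∀ s t : unitInterval, s < t → c '' Set.Icc s t ⊆ frontier D.carrier →
      (c '' Set.Icc s t).Subsingleton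

/-- **Cardy's formula for the family `P` in every conformal rectangle** — the exact shape of the
tree's SLE₆ fact `sle_six_measureReal_hitsBefore` (crit-perc.S21) with `IsSLELaw 6` replaced by
the family's own law: the curve of `(Ω; a', c')` hits `(c'd') = R.arc 2` before
`(b'c') = R.arc 1` with probability `F(η(x))` for every uniformizing datum `(φ, x)`. -/
def CardyCrossing (P : ChordalFamily) : Prop :=
  ∀ (R : ConformalRectangle) (φ : ConformalEquiv upperHalfPlaneSet R.carrier) (x : Fin 4 → ℝ),
    R.IsUniformizing φ x →
      (P (R.chord 0 2 (by decide))).real (CurveClass.hitsBefore (R.arc 2) (R.arc 1)) =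
        cardyFunction (crossRatio x)

/-! ### The a-priori package (transfer target) -/

/-- Complex conjugation as a homeomorphism of the plane (the orientation-REVERSING similarity
missing from `IsSimilarityCovariant`). -/
def conjHomeo : ℂ ≃ₜ ℂ := Complex.conjCLE.toHomeomorph

/-- **A-priori package `SmirnovRegular P`** (standard outputs of RSW / colour symmetry for every
subsequential scaling limit of critical percolation interfaces; the abstract shadow of the
informal clause (iv) of the crux that this line actually spends):
* `reflect` — ACHIRALITY: covariance under complex conjugation (with similarity covariance:
  under all similarities). Needed for colour switching (`stub_cellDipole`) and the crossing
  duality (37b) (`stub_boundaryDuality`); TightnessNotes B2.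
* `noPointHit` — no fixed interior point lies on the curve. Kills every germ-decorated junk
  family on record (J1/J2/J2'' chords, bisector explorers: deterministic segments) and gives
  interior continuity of the separation functions.
* `instantReturn` — (E4) the curve touches BOTH boundary arcs arbitrarily close to its starting
  point (κ > 4 behaviour). Kills arc tracers/chord starters; gives the vertex values of (37). -/
structure SmirnovRegular (P : ChordalFamily) : Prop where
  reflect : ∀ D : DobrushinDomain,
    P (D.map conjHomeo) = (P D).map (CurveClass.map (conjHomeo : C(ℂ, ℂ)))
  noPointHit : ∀ D : DobrushinDomain, ∀ z ∈ D.carrier, P D {γ | z ∈ γ.range} = 0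
  instantReturn : ∀ D : DobrushinDomain, ∀ᵐ γ ∂(P D), ∀ ε : ℝ, 0 < ε → ∀ k : Fin 2,
    ∃ x ∈ D.arc k, x ≠ D.pt 0 ∧ dist x (D.pt 0) < ε ∧ x ∈ γ.range

/-! ### Smirnov's separation functions of an abstract chordal family -/

/-- Total increment of `arg (p s − z)` along a path `p : [0,1] → ℂ` avoiding `z`: lift
`s ↦ p s − z` through the covering map `exp : ℂ → ℂ ∖ {0}` (Mathlib `IsCoveringMap.liftPath`)
and take the imaginary part of (lift at `1`) − (lift at `0`). Junk `0` if the path meets `z`. -/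
def argIncrement (p : C(I, ℂ)) (z : ℂ) : ℝ :=
  if h : ∀ s, p s ≠ z then
    (isCoveringMap_expCover.liftPath
        (⟨fun s => ⟨p s - z, sub_ne_zero.2 (h s)⟩,
          (p.continuous.sub continuous_const).subtype_mk _⟩ : C(I, CStar))
        (Complex.log (p 0 - z))
        (Subtype.ext (Complex.exp_log (sub_ne_zero.2 (h 0))).symm) 1 : ℂ).im
      - (Complex.log (p 0 - z)).im
  else 0

variable (T : MarkedDomain 3) (i : Fin 3)

/-- `t_L`: the last parameter `≤ t_R` at which the curve visits the side arc `A_{i+2}` (the arc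
adjacent to its starting corner `pt i`), where `t_R = hitParam (A_{i+1})` is its first visit of
the other side arc; `0` is always admissible. -/
def lastSideVisit (c : Curve ℂ) : ℝ :=
  sSup ({t : ℝ | ∃ h : t ∈ I, t ≤ c.hitParam (T.arc (i + 1)) ∧ c ⟨t, h⟩ ∈ T.arc (i + 2)} ∪ {0})

/-- The **spanning piece** `c|[t_L, t_R]` rescaled to `[0,1]` (clamped affine reparametrisation,
as `Curve.stopAt`). In the percolation dictionary its far face is the unique segment of the
interface's outer face that crosses from `A_{i+2}` to `A_{i+1}`. -/
def spanPiece (c : Curve ℂ) : C(I, ℂ) :=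
  c.toContinuousMap.comp
    (Curve.affineClamp (lastSideVisit T i c) (c.hitParam (T.arc (i + 1)) - lastSideVisit T i c))

/-- A boundary parameter in `[mark j, nextMark j]` of a point of `arc j` (junk `mark j` if the
point is not on that arc). -/
def arcParam (T : MarkedDomain 3) (j : Fin 3) (x : ℂ) : ℝ :=
  if h : ∃ τ ∈ Set.Icc (T.mark j) (T.nextMark j), T.boundary τ = x then h.choose else T.mark j

/-- Boundary parameter of `f_R = c t_R ∈ A_{i+1}`. -/
def paramR (c : Curve ℂ) : ℝ :=
  arcParam T (i + 1) (spanPiece T i c 1)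

/-- Boundary parameter of `f_L = c t_L ∈ A_{i+2}`, moved to the period that starts at
`nextMark (i+1)` so that the parameter interval `[paramR, paramL]` runs forward through the
vertex `pt (i+2)`. -/
def paramL (c : Curve ℂ) : ℝ :=
  arcParam T (i + 2) (spanPiece T i c 0) + (T.nextMark (i + 1) - T.mark (i + 2))

/-- The **closing boundary path**: along `∂Ω` from `f_R` forward through the opposite vertex
`pt (i+2)` to `f_L` (inside `A_{i+1} ∪ A_{i+2}`). -/
def closingPath (c : Curve ℂ) : C(I, ℂ) where
  toFun s := T.boundary (paramR T i c + (s : ℝ) * (paramL T i c - paramR T i c))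
  continuous_toFun :=
    T.continuous_boundary.comp (continuous_const.add (continuous_subtype_val.mul continuous_const))

/-- `2π ×` the winding number around `z` of the loop "spanning piece, then back along the
boundary through the opposite vertex" (sum of the two argument increments). -/
def spanWinding (c : Curve ℂ) (z : ℂ) : ℝ :=
  argIncrement (spanPiece T i c) z + argIncrement (closingPath T i c) z

/-- **Smirnov's separating event `Qⁱ(z)` on one curve.** For the curve of `(T; pt i, pt (i+1))`:
`z ∈ Ω`, `z` is off the spanning piece, and the loop (spanning piece + boundary through
`pt (i+2)`) winds around `z`.
PERCOLATION DICTIONARY (why this is Smirnov's `Q`, Bollobás–Riordan (9)): colour `Aᵢ` yellow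
and `A_{i+1} ∪ A_{i+2}` blue; the curve is the interface bounding the yellow cluster of `Aᵢ`;
its blue outer face is a chain of interior blue paths between consecutive contacts with the blue
arcs; contacts with `A_{i+2}` all precede contacts with `A_{i+1}` (after the first
`A_{i+1}`-contact the accessible boundary contains no point of `A_{i+2}`), so EXACTLY ONE face
segment — the face of the spanning piece — runs from `A_{i+2}` to `A_{i+1}`; a blue interior
`A_{i+1}`–`A_{i+2}` path separating `z` from `Aᵢ` exists iff `z` lies on the far side of that
segment (caps against one side arc, pinched bubbles on the yellow side and the pockets against
`Aᵢ` are all on the winding-`0` side once only the spanning piece is removed; blue bubbles of the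
spanning piece inherit the winding of the far side). Deterministic segments / explorers make this
event deterministic; for `tipFamily` it is empty. -/
def smirnovEvent (z : ℂ) : Set (CurveClass ℂ) :=
  CurveClass.mk '' {c : Curve ℂ |
    z ∈ T.carrier ∧ z ∉ Set.range (spanPiece T i c) ∧ spanWinding T i c z ≠ 0}

/-- The Dobrushin marking `(T; pt j, pt k)` of a 3-marked domain for distinct `j, k` (through
`chord` if `j < k`, else through `chord` and `swap`; for admissible `P` the law depends on the
marking only through `(carrier, pt j, pt k)` — Disproof.lean §3). -/
def twoMarks (T : MarkedDomain 3) (j k : Fin 3) (h : j ≠ k) : DobrushinDomain :=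
  if hjk : j < k then T.chord j k hjk
  else (T.chord k j (lt_of_le_of_ne (not_lt.1 hjk) (Ne.symm h))).swap

/-- In `Fin 3`, `i ≠ i + 1`. -/
theorem fin3_ne_add_one : ∀ i : Fin 3, i ≠ i + 1 := by decide

/-- **Smirnov's separation function** `Gⁱ(z) = sepFun P T i z` of the family `P` in the 3-marked
Jordan domain `T`: the probability, under the law of the curve from `pt i` to `pt (i+1)`, of the
separating event `Qⁱ(z)` (Smirnov 2001 `H`, Bollobás–Riordan (9) `gⁱ`, "small on `Aᵢ`"). -/
def sepFun (P : ChordalFamily) (T : MarkedDomain 3) (i : Fin 3) (z : ℂ) : ℝ :=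
  (P (twoMarks T i (i + 1) (fin3_ne_add_one i))).real (smirnovEvent T i z)

/-! ### The registered stubs -/

/-- **stub (TRANSFER) — a-priori package from the typed axioms.** The typed hypotheses of the
crux imply achirality, no-fixed-point-hit and instant boundary return. This is exactly where a
germ-decorated junk family (J1/J2''/explorers of the item evidence) would falsify the typed crux;
for the repaired crux (clause (iv) / E4–E5 / reversibility) this stub is replaced by the
hypothesis and nothing else changes. [size: ? — false iff the typed crux is false by junk] -/
theorem stub_aprioriFromAxioms :
    ∀ P : ChordalFamily, IsLocalMarkovChordalFamily P → NonTracing P → SmirnovRegular P := by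
  sorry

/-- **stub S2 — boundary duality / Smirnov regularity (Bollobás–Riordan Claims 22–23 (37) for an
abstract family).** The three separation functions of an admissible regular family in a conformal
rectangle extend continuously to the closed domain, take values in `[0,1]`, have the boundary
values (37) — `Gⁱ = 0` on `Aᵢ` (boundary absorption) and `G^{i+1} + G^{i+2} = 1` on `Aᵢ` (the
crossing DUALITY between the curves from `pt (i+1)` and from `pt (i+2)`: target independence +
achirality) — and at the fourth point `d'` the value `G¹(d')` is the family's crossing
probability of `R` in the tree's convention (curve `a' → c'` hits `(c'd')` before `(b'c')`;
target independence). Uses the target clause of `IsChordal` (tipFamily has `G ≡ 0`).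
[size: L] -/
theorem stub_boundaryDuality :
    ∀ P : ChordalFamily, IsLocalMarkovChordalFamily P → NonTracing P → SmirnovRegular P →
      ∀ R : ConformalRectangle, ∃ G : Fin 3 → ℂ → ℝ,
        (∀ i, ContinuousOn (G i) (closure R.carrier)) ∧
        (∀ i, ∀ z ∈ R.carrier, G i z = sepFun P (MarkedDomain.forgetLast R) i z) ∧
        (∀ i, ∀ z ∈ closure R.carrier, G i z ∈ Set.Icc (0 : ℝ) 1) ∧
        (∀ i, ∀ z ∈ (MarkedDomain.forgetLast R).arc i,
          G i z = 0 ∧ G (i + 1) z + G (i + 2) z = 1) ∧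
        G 1 (R.pt 3) =
          (P (R.chord 0 2 (by decide))).real (CurveClass.hitsBefore (R.arc 2) (R.arc 1)) := by
  sorry

/-- **stub S1a — the `2π/3` cell DIPOLE identity (THE BET; consumes rotation covariance).** For
an admissible regular family, a conformal rectangle with a Carleson datum (only the orientation
root `ω = triangleTurn a b c = e^{±2πi/3}` is read off it), every compact `K ⊆ Ω` and every unit
direction `η`: `Gⁱ(z+εη) − Gⁱ(z) − (G^{i+1}(z+εωη) − G^{i+1}(z)) = o(ε)` uniformly in `z ∈ K`.
This is the derivative form of Bollobás–Riordan's contour relation (36) and the continuum avatar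
of Smirnov's Lemma 2.1 `P_α(z,η) = P_{τα}(z,τη)`; exact for the Carleson linear functions and for
SLE₆ (conformal invariance). Intended proof: exact colour switching of three-arm events from an
artificial ε-cell on the `P`-exploration structure (Markov + locality + target independence +
`reflect`) + isotropy of the first-order three-arm response (similarity covariance); the
stretched family `(A⁻¹)_* SLE₆(A·)` fails exactly here. [size: XL / open] -/
theorem stub_cellDipole :
    ∀ P : ChordalFamily, IsLocalMarkovChordalFamily P → NonTracing P → SmirnovRegular P →
      ∀ (R : ConformalRectangle) (a b c d : ℂ)
        (ψ : ConformalEquiv R.carrier (openTriangle a b c)),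
        IsEquilateral a b c → d ∈ openSegment ℝ c a → IsCarlesonMap R a b c d ψ →
        ∀ (i : Fin 3) (K : Set ℂ), IsCompact K → K ⊆ R.carrier → ∀ η : ℂ, ‖η‖ = 1 →
          TendstoUniformlyOn
            (fun (ε : ℝ) (z : ℂ) =>
              (sepFun P (MarkedDomain.forgetLast R) i (z + (ε : ℂ) * η)
                  - sepFun P (MarkedDomain.forgetLast R) i z
                - (sepFun P (MarkedDomain.forgetLast R) (i + 1)
                      (z + (ε : ℂ) * (triangleTurn a b c * η))
                  - sepFun P (MarkedDomain.forgetLast R) (i + 1) z)) / ε)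
            (fun _ => (0 : ℝ)) (𝓝[>] (0 : ℝ)) K := by
  sorry

/-- **stub S1b — from the cell dipole identity to the contour relation (36) (pure analysis).**
If `Gⁱ, G^{i+1}` are continuous on an open set `U` and satisfy the uniform-on-compacts dipole
identity with a unit `ω`, then `∮_{∂T} (G^{i+1} − ω Gⁱ) dz = 0` for every solid triangle
`T ⊆ U`. (Mollify: for smooth functions the identity reads `D G^{i+1}[ωη] = D Gⁱ[η]`, i.e.
`∂̄G^{i+1} = ω ∂̄Gⁱ` since `|ω| = 1`, and Green's formula gives (36); pass to the limit in the
mollification using local uniformity. Smirnov's Lemma 2.3/2.4 is the lattice version.)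
[size: M, true] -/
theorem stub_contourFromCells :
    ∀ (U : Set ℂ) (G : Fin 3 → ℂ → ℝ) (ω : ℂ) (i : Fin 3), IsOpen U → ‖ω‖ = 1 →
      ContinuousOn (G i) U → ContinuousOn (G (i + 1)) U →
      (∀ K : Set ℂ, IsCompact K → K ⊆ U → ∀ η : ℂ, ‖η‖ = 1 →
        TendstoUniformlyOn
          (fun (ε : ℝ) (z : ℂ) =>
            (G i (z + (ε : ℂ) * η) - G i z
              - (G (i + 1) (z + (ε : ℂ) * (ω * η)) - G (i + 1) z)) / ε)
          (fun _ => (0 : ℝ)) (𝓝[>] (0 : ℝ)) K) →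
      ∀ p q r : ℂ, convexHull ℝ {p, q, r} ⊆ U →
        triangleIntegral (fun w => (G (i + 1) w : ℂ) - ω * G i w) p q r = 0 := by
  sorry

/-- **stub S3 — Jordan–Cardy ⇒ SLE₆ (the common back end F3; known template).** An admissible
regular family with Cardy's crossing formula in EVERY conformal rectangle is the chordal SLE₆ law
in every Dobrushin domain (Smirnov 2001 Thm 2; Camia–Newman 2007 Thm 5; Werner 2007 §4: the
Cardy data of all 4-marked sub-configurations determine the exit distributions, the Markov
property makes the conformal-image driving function a continuous martingale with the SLE₆
quadratic variation; the SLE₆ trace in the tree's `IsSLELaw` sense is produced from `P`'s own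
curves, so Rohde–Schramm is not an input). Typed over `ConformalRectangle` /
`hitsBefore (R.arc 2) (R.arc 1)` for `R.chord 0 2` as the triage required (the `MarkedDomain 3`
form is vacuous, TriageF2). Contains the kernel-identification step at non-Jordan remaining
domains (REVIEW §2.5). [size: XL, known template] -/
theorem stub_jordanCardyToSLE6 :
    ∀ P : ChordalFamily, IsLocalMarkovChordalFamily P → NonTracing P → SmirnovRegular P →
      CardyCrossing P → ∀ D : DobrushinDomain, IsSLELaw 6 D (P D) := by
  sorry

/-! ### Proved glue -/

/-- The dipole property transfers from `F` to any `G` agreeing with `F` on the open set `U`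
(compacts of `U` have a thickening inside `U`, so for small `ε` all evaluation points stay in
`U`). -/
theorem dipole_congr {U K : Set ℂ} {F G : Fin 3 → ℂ → ℝ} (hU : IsOpen U) (hK : IsCompact K)
    (hKU : K ⊆ U) (hFG : ∀ j, ∀ z ∈ U, G j z = F j z) {ω η : ℂ} (hω : ‖ω‖ = 1) (hη : ‖η‖ = 1)
    {i : Fin 3}
    (h : TendstoUniformlyOn
      (fun (ε : ℝ) (z : ℂ) =>
        (F i (z + (ε : ℂ) * η) - F i z - (F (i + 1) (z + (ε : ℂ) * (ω * η)) - F (i + 1) z)) / ε)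
      (fun _ => (0 : ℝ)) (𝓝[>] (0 : ℝ)) K) :
    TendstoUniformlyOn
      (fun (ε : ℝ) (z : ℂ) =>
        (G i (z + (ε : ℂ) * η) - G i z - (G (i + 1) (z + (ε : ℂ) * (ω * η)) - G (i + 1) z)) / ε)
      (fun _ => (0 : ℝ)) (𝓝[>] (0 : ℝ)) K := by
  obtain ⟨δ, hδ, hδU⟩ := hK.exists_cthickening_subset_open hU hKU
  refine h.congr ?_
  filter_upwards [Ioo_mem_nhdsGT hδ] with ε hε z hz
  have hz0 : z ∈ U := hKU hz
  have hmem : ∀ v : ℂ, ‖v‖ = 1 → z + (ε : ℂ) * v ∈ U := by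
    intro v hv
    refine hδU (thickening_subset_cthickening δ K ?_)
    rw [mem_thickening_iff]
    refine ⟨z, hz, ?_⟩
    rw [dist_eq_norm, add_sub_cancel_left, norm_mul, Complex.norm_real, Real.norm_eq_abs, hv,
      mul_one, abs_of_pos hε.1]
    exact hε.2
  have hωη : ‖ω * η‖ = 1 := by rw [norm_mul, hω, hη, mul_one]
  simp only [hFG _ _ hz0, hFG _ _ (hmem η hη), hFG _ _ (hmem _ hωη)]

/-- **Cardy in every conformal rectangle from S2 + S1a + S1b** (the heart of the composition):
`smirnov_claim24_holds` identifies the extended separation triple with the Carleson linear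
functions, the boundary limit at `d'` reads off Carleson's ratio, and the Cardy–Carleson
identity converts it to `F(η(x))`. -/
theorem cardyCrossing_of_stubs {P : ChordalFamily} (hP : IsLocalMarkovChordalFamily P)
    (hnt : NonTracing P) (hreg : SmirnovRegular P)
    (hBD : ∀ P : ChordalFamily, IsLocalMarkovChordalFamily P → NonTracing P → SmirnovRegular P →
      ∀ R : ConformalRectangle, ∃ G : Fin 3 → ℂ → ℝ,
        (∀ i, ContinuousOn (G i) (closure R.carrier)) ∧
        (∀ i, ∀ z ∈ R.carrier, G i z = sepFun P (MarkedDomain.forgetLast R) i z) ∧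
        (∀ i, ∀ z ∈ closure R.carrier, G i z ∈ Set.Icc (0 : ℝ) 1) ∧
        (∀ i, ∀ z ∈ (MarkedDomain.forgetLast R).arc i,
          G i z = 0 ∧ G (i + 1) z + G (i + 2) z = 1) ∧
        G 1 (R.pt 3) =
          (P (R.chord 0 2 (by decide))).real (CurveClass.hitsBefore (R.arc 2) (R.arc 1)))
    (hCD : ∀ P : ChordalFamily, IsLocalMarkovChordalFamily P → NonTracing P → SmirnovRegular P →
      ∀ (R : ConformalRectangle) (a b c d : ℂ)
        (ψ : ConformalEquiv R.carrier (openTriangle a b c)),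
        IsEquilateral a b c → d ∈ openSegment ℝ c a → IsCarlesonMap R a b c d ψ →
        ∀ (i : Fin 3) (K : Set ℂ), IsCompact K → K ⊆ R.carrier → ∀ η : ℂ, ‖η‖ = 1 →
          TendstoUniformlyOn
            (fun (ε : ℝ) (z : ℂ) =>
              (sepFun P (MarkedDomain.forgetLast R) i (z + (ε : ℂ) * η)
                  - sepFun P (MarkedDomain.forgetLast R) i z
                - (sepFun P (MarkedDomain.forgetLast R) (i + 1)
                      (z + (ε : ℂ) * (triangleTurn a b c * η))
                  - sepFun P (MarkedDomain.forgetLast R) (i + 1) z)) / ε)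
            (fun _ => (0 : ℝ)) (𝓝[>] (0 : ℝ)) K)
    (hCC : ∀ (U : Set ℂ) (G : Fin 3 → ℂ → ℝ) (ω : ℂ) (i : Fin 3), IsOpen U → ‖ω‖ = 1 →
      ContinuousOn (G i) U → ContinuousOn (G (i + 1)) U →
      (∀ K : Set ℂ, IsCompact K → K ⊆ U → ∀ η : ℂ, ‖η‖ = 1 →
        TendstoUniformlyOn
          (fun (ε : ℝ) (z : ℂ) =>
            (G i (z + (ε : ℂ) * η) - G i z
              - (G (i + 1) (z + (ε : ℂ) * (ω * η)) - G (i + 1) z)) / ε)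
          (fun _ => (0 : ℝ)) (𝓝[>] (0 : ℝ)) K) →
      ∀ p q r : ℂ, convexHull ℝ {p, q, r} ⊆ U →
        triangleIntegral (fun w => (G (i + 1) w : ℂ) - ω * G i w) p q r = 0) :
    CardyCrossing P := by
  intro R φ x hφ
  obtain ⟨a, b, c, d, ψ, habc, hd, hψ⟩ := exists_isCarlesonMap_holds R
  rw [cardyFunction_crossRatio_eq_carlesonRatio_holds R a b c d ψ φ x habc hd hψ hφ]
  obtain ⟨G, hcont, hG, hIcc, h37, hd'⟩ := hBD P hP hnt hreg R
  -- (36) for the extended triple on the open carrier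
  have h36 : ∀ (i : Fin 3) (p q r : ℂ), convexHull ℝ {p, q, r} ⊆ R.carrier →
      triangleIntegral (fun w => (G (i + 1) w : ℂ) - triangleTurn a b c * G i w) p q r = 0 := by
    intro i p q r hpqr
    refine hCC R.carrier G (triangleTurn a b c) i R.isOpen (norm_triangleTurn_of_isEquilateral habc)
      ((hcont i).mono subset_closure) ((hcont (i + 1)).mono subset_closure) ?_ p q r hpqr
    intro K hK hKU η hη
    exact dipole_congr R.isOpen hK hKU hG (norm_triangleTurn_of_isEquilateral habc) hη
      (hCD P hP hnt hreg R a b c d ψ habc hd hψ i K hK hKU η hη)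
  -- Bollobás–Riordan Claim 24 (PROVED in tree): the triple is the Carleson triple
  have hcl := smirnov_claim24_holds R a b c ψ G habc hψ.1 hψ.2.1 hψ.2.2.1 hcont hIcc h36 h37
  -- boundary limit at `d' = R.pt 3`
  have hd3 : R.pt 3 ∈ closure R.carrier := frontier_subset_closure (R.pt_mem_frontier 3)
  haveI : (𝓝[R.carrier] (R.pt 3)).NeBot := mem_closure_iff_nhdsWithin_neBot.1 hd3
  have h1 : Tendsto (G 1) (𝓝[R.carrier] (R.pt 3)) (𝓝 (G 1 (R.pt 3))) :=
    (hcont 1 (R.pt 3) hd3).tendsto.mono_left (nhdsWithin_mono _ subset_closure)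
  have h2 : Tendsto (fun z => carlesonLinear a b c 1 (ψ z)) (𝓝[R.carrier] (R.pt 3))
      (𝓝 (carlesonLinear a b c 1 d)) :=
    ((continuous_carlesonLinear a b c 1).tendsto d).comp hψ.2.2.2
  have heq : ∀ᶠ z in 𝓝[R.carrier] (R.pt 3), G 1 z = carlesonLinear a b c 1 (ψ z) :=
    eventually_nhdsWithin_of_forall fun z hz => hcl 1 z hz
  have hlim : G 1 (R.pt 3) = carlesonLinear a b c 1 d := tendsto_nhds_unique (h1.congr' heq) h2
  rw [← hd', hlim]
  exact carlesonLinear_one_eq_carlesonRatio habc hd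

/-! ### The composition: the stubs imply the crux BY NAME -/

/-- Local alias of the crux statement, used only as the conclusion of the sorry-free implication
`crux_of_stubStatements` (so that exactly ONE theorem of this file, `CardyRotToConfR2SymmetryUpgrade_of`,
concludes the route decl itself by name, as the skeleton audit requires). -/
def LineTarget : Prop :=
  Summit.CriticalPhenomena.CardyFormulaZ2.Theses.CardyRotToConf.CardyRotToConfR2SymmetryUpgrade


/-- **The sorry-free implication** (standard axioms only): the five stub STATEMENTS — transfer,
boundary duality, cell dipole, contour lemma, Jordan–Cardy-to-SLE₆ — imply the crux statement
(`LineTarget` is by definition `CardyRotToConf.CardyRotToConfR2SymmetryUpgrade`). -/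
theorem crux_of_stubStatements :
    (∀ P : ChordalFamily, IsLocalMarkovChordalFamily P → NonTracing P → SmirnovRegular P) →
    (∀ P : ChordalFamily, IsLocalMarkovChordalFamily P → NonTracing P → SmirnovRegular P →
      ∀ R : ConformalRectangle, ∃ G : Fin 3 → ℂ → ℝ,
        (∀ i, ContinuousOn (G i) (closure R.carrier)) ∧
        (∀ i, ∀ z ∈ R.carrier, G i z = sepFun P (MarkedDomain.forgetLast R) i z) ∧
        (∀ i, ∀ z ∈ closure R.carrier, G i z ∈ Set.Icc (0 : ℝ) 1) ∧
        (∀ i, ∀ z ∈ (MarkedDomain.forgetLast R).arc i,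
          G i z = 0 ∧ G (i + 1) z + G (i + 2) z = 1) ∧
        G 1 (R.pt 3) =
          (P (R.chord 0 2 (by decide))).real (CurveClass.hitsBefore (R.arc 2) (R.arc 1))) →
    (∀ P : ChordalFamily, IsLocalMarkovChordalFamily P → NonTracing P → SmirnovRegular P →
      ∀ (R : ConformalRectangle) (a b c d : ℂ)
        (ψ : ConformalEquiv R.carrier (openTriangle a b c)),
        IsEquilateral a b c → d ∈ openSegment ℝ c a → IsCarlesonMap R a b c d ψ →
        ∀ (i : Fin 3) (K : Set ℂ), IsCompact K → K ⊆ R.carrier → ∀ η : ℂ, ‖η‖ = 1 →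
          TendstoUniformlyOn
            (fun (ε : ℝ) (z : ℂ) =>
              (sepFun P (MarkedDomain.forgetLast R) i (z + (ε : ℂ) * η)
                  - sepFun P (MarkedDomain.forgetLast R) i z
                - (sepFun P (MarkedDomain.forgetLast R) (i + 1)
                      (z + (ε : ℂ) * (triangleTurn a b c * η))
                  - sepFun P (MarkedDomain.forgetLast R) (i + 1) z)) / ε)
            (fun _ => (0 : ℝ)) (𝓝[>] (0 : ℝ)) K) →
    (∀ (U : Set ℂ) (G : Fin 3 → ℂ → ℝ) (ω : ℂ) (i : Fin 3), IsOpen U → ‖ω‖ = 1 →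
      ContinuousOn (G i) U → ContinuousOn (G (i + 1)) U →
      (∀ K : Set ℂ, IsCompact K → K ⊆ U → ∀ η : ℂ, ‖η‖ = 1 →
        TendstoUniformlyOn
          (fun (ε : ℝ) (z : ℂ) =>
            (G i (z + (ε : ℂ) * η) - G i z
              - (G (i + 1) (z + (ε : ℂ) * (ω * η)) - G (i + 1) z)) / ε)
          (fun _ => (0 : ℝ)) (𝓝[>] (0 : ℝ)) K) →
      ∀ p q r : ℂ, convexHull ℝ {p, q, r} ⊆ U →
        triangleIntegral (fun w => (G (i + 1) w : ℂ) - ω * G i w) p q r = 0) →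
    (∀ P : ChordalFamily, IsLocalMarkovChordalFamily P → NonTracing P → SmirnovRegular P →
      CardyCrossing P → ∀ D : DobrushinDomain, IsSLELaw 6 D (P D)) →
    LineTarget := by
  intro hT hBD hCD hCC hJ P hP hnt D
  have hreg : SmirnovRegular P := hT P hP hnt
  exact hJ P hP hnt hreg (cardyCrossing_of_stubs hP hnt hreg hBD hCD hCC) D

/-- **The skeleton theorem: the line closes the crux BY NAME.** The registered stubs, composed by
`crux_of_stubStatements`, prove `CardyRotToConfR2SymmetryUpgrade` (route CardyRotToConf, r2); it is
closed exactly when the five stubs are proved (until then its only non-standard axiom is the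
stubs' `sorryAx`). -/
theorem CardyRotToConfR2SymmetryUpgrade_of :
    Summit.CriticalPhenomena.CardyFormulaZ2.Theses.CardyRotToConf.CardyRotToConfR2SymmetryUpgrade :=
  crux_of_stubStatements stub_aprioriFromAxioms stub_boundaryDuality stub_cellDipole
    stub_contourFromCells stub_jordanCardyToSLE6

/-- The same for the shared decl of route CardySelfRefinement (`SymmetryUpgrade`, definitionally the
same statement as `CardyRotToConf.CardyRotToConfR2SymmetryUpgrade`). -/
theorem SymmetryUpgrade_of :
    Summit.CriticalPhenomena.CardyFormulaZ2.Theses.CardySelfRefinement.SymmetryUpgrade :=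
  CardyRotToConfR2SymmetryUpgrade_of

end Summit.CriticalPhenomena.CardyFormulaZ2.Cruxes.CardyRotToConfR2SymmetryUpgrade.ContinuumSmirnovDipole

end
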